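import Summits.Ventures.GridStability.Lyapunov.RelativeLffNonUniform
import HarnessLib

/-!
# GridStability/Lyapunov/RelativeLffNonUniformRefT — generic NON-UNIFORM-damping LFF closed form,
# part 2: reference machine `0` (`T = refT`): Sherman–Morrison, the residual `X` in closed form, and
# the SCALAR sufficient condition `h(M_i/D_i + τ) ≤ c′` for `X ⪰ 0`

Venture GRIDFUSION, LFF lane, lead RULING R-LFF-NU-ROW (2026-08-27T06:44:49Z, «generic statement
pending»); seat gridfusion-lyap-1 (g5); namespace `Summit.Ventures.GridStability.Lyapunov.RelativeLffNU`.
Part 1 (`RelativeLffNonUniform.lean`, p522397): the LMI (QKH) [cite: VuTuritsyn2016, §III eq. (QKH)] on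
Pai's machine-reference structure [cite: Pai1981, §3.6.3 eq. (3.45)] collapses, on the three exact faces
of the closed form `Q = [[c′M, hΛ⁻¹TᵀÑ⁻¹], [hÑ⁻¹TΛ⁻¹, hÑ⁻¹]]`, `K = c′w`, `H = hw`, to the residual
`X = Q_ωωΛ + ΛQ_ωω − Q_σωᵀT − TᵀQ_σω ⪰ 0` (`closedFormCert`). HERE, for the reference-machine
structure `T = refT n` (machines `0..n`, lit-6 `InternalNode.refT`) and EVERY positive `D`:

§3 `NinvD D = diag(D′) − D′D′ᵀ/ΣD` (`D′_a = D_{a+1}`, `ΣD` over ALL machines) IS the inverse of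
`Ñ = TD⁻¹Tᵀ = diag(1/D′) + (1/D_0)𝟙𝟙ᵀ` (`refT_mul_diagonal_mul_transpose`, `NinvD_mul` — Sherman–Morrison,
proved); §4 `refTᵀÑ⁻¹refT = diag(D) − uuᵀ/ΣD`, `u = (D_i)_i` (`refT_transpose_mul_NinvD_mul_refT`: the
`D`-weighted projection off the common-speed direction); §5 hence the residual ENTRYWISE
`X_ij = [i=j](2c′D_i − 2hM_i) + (h/ΣD)(M_iD_j + D_iM_j)`, i.e. `X = 2c′D − h(2M − (muᵀ + umᵀ)/ΣD)`, and
its quadratic form `vᵀXv = Σ(2c′D_i − 2hM_i)v_i² + (2h/ΣD)(ΣM_iv_i)(ΣD_iv_i)`; §6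
`XOf_refT_posSemidef`: **`X ⪰ 0` WHENEVER `h·(M_i/D_i + τ) ≤ c′` for all `i` with `τ²·ΣD ≥ Σ M_i²/D_i`**
(`h, τ ≥ 0`; two weighted Cauchy–Schwarz inequalities `|ΣM_iv_i|·|ΣD_iv_i| ≤ τ·ΣD·ΣD_iv_i²`) — a SCALAR
test, any number of machines, no semidefinite programme. Part 3 (`RelativeLffNonUniformCert.lean`):
`Q ≻ 0` under `h·M_i/D_i < c′`, a coercivity margin by compactness, and the solver-free certificate
`exists_closedFormCert` for EVERY lossless model with positive per-machine damping.

THREE COLUMNS. CERTIFIED (kernel): theorem schemata about the MODEL CLASS = lossless network-reduced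
classical multimachine model with per-machine damping `D_i > 0` (MV-2L, NO MV-λ) in Pai's
machine-reference coordinates. VALIDATED: nothing (no solver). No sentence of this file says that any
grid is stable. Definitions: `Dsum`, `NinvD` (bookkeeping); no named fact; standard axioms.
-/

noncomputable section

open Real Set Filter Matrix Finset
open Literature.MathematicalPhysics.PowerSystems
open Literature.MathematicalPhysics.PowerSystems.LyapunovFunctionFamily
open InternalNode (refT)

namespace Summit.Ventures.GridStability.Lyapunov.RelativeLffNU

variable {n : ℕ}

/-! ### §3 `T = refT` (reference machine `0`): the Sherman–Morrison inverse of `Ñ = TD⁻¹Tᵀ` -/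

/-- `ΣD = Σ_i D_i` over ALL machines (reference included). -/
def Dsum (D : Fin (n + 1) → ℝ) : ℝ := ∑ i, D i

/-- **`Ñ⁻¹ = diag(D′) − D′D′ᵀ/ΣD`**, `D′_a = D_{a+1}` — the Sherman–Morrison inverse of
`Ñ = TD⁻¹Tᵀ = diag(1/D′) + (1/D_0)𝟙𝟙ᵀ` for `T = refT`. -/
def NinvD (D : Fin (n + 1) → ℝ) : Matrix (Fin n) (Fin n) ℝ :=
  Matrix.diagonal (fun a => D a.succ) - (1 / Dsum D) • Matrix.vecMulVec (fun a => D a.succ) (fun a => D a.succ)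

/-- Entries of `Ñ⁻¹`. -/
theorem NinvD_apply (D : Fin (n + 1) → ℝ) (a b : Fin n) :
    NinvD D a b = (if a = b then D a.succ else 0) - 1 / Dsum D * (D a.succ * D b.succ) := by
  simp [NinvD, Matrix.diagonal_apply, Matrix.vecMulVec_apply]

/-- `Ñ⁻¹` is symmetric. -/
theorem NinvD_transpose (D : Fin (n + 1) → ℝ) : (NinvD D)ᵀ = NinvD D := by
  ext a b
  rw [Matrix.transpose_apply, NinvD_apply, NinvD_apply]
  by_cases h : a = b
  · subst h; rfl
  · rw [if_neg h, if_neg (Ne.symm h)]; ring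

/-- `T·diag(e)·Tᵀ = diag(e′) + e_0·𝟙𝟙ᵀ` for `T = refT` (`e′_a = e_{a+1}`). -/
theorem refT_mul_diagonal_mul_transpose (e : Fin (n + 1) → ℝ) :
    refT n * (Matrix.diagonal e * (refT n)ᵀ)
      = Matrix.diagonal (fun a => e a.succ) + Matrix.of (fun (_ : Fin n) (_ : Fin n) => e 0) := by
  ext a b
  rw [Matrix.mul_apply, Matrix.add_apply, Matrix.diagonal_apply, Matrix.of_apply]
  have hT : ∀ (c : Fin n) (i : Fin (n + 1)),
      refT n c i = (if i = c.succ then 1 else 0) - (if i = 0 then 1 else 0) := fun c i => rfl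
  have hrow : ∀ i, (Matrix.diagonal e * (refT n)ᵀ) i b = e i * refT n b i := by
    intro i; rw [Matrix.diagonal_mul, Matrix.transpose_apply]
  have hza : ((0 : Fin (n + 1)) = a.succ) = False := propext ⟨fun h => Fin.succ_ne_zero a h.symm, False.elim⟩
  have hzb : ((0 : Fin (n + 1)) = b.succ) = False := propext ⟨fun h => Fin.succ_ne_zero b h.symm, False.elim⟩
  simp only [hrow, hT, Fin.sum_univ_succ, Fin.succ_ne_zero, if_false, if_true, sub_zero, Fin.succ_inj,
    hza, hzb, ite_mul, one_mul, zero_mul, Finset.sum_ite_eq', Finset.mem_univ, mul_ite, mul_one,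
    mul_zero]
  by_cases hab : a = b
  · subst hab; simp [add_comm]
  · simp [hab, Ne.symm hab]

/-- **Sherman–Morrison**: `Ñ⁻¹ · (T D⁻¹ Tᵀ) = 1` for `T = refT` and every `D > 0`. -/
theorem NinvD_mul (D : Fin (n + 1) → ℝ) (hD : ∀ i, 0 < D i) :
    NinvD D * (refT n * (Matrix.diagonal (fun i => 1 / D i) * (refT n)ᵀ)) = 1 := by
  rw [refT_mul_diagonal_mul_transpose]
  have hD' : ∀ a : Fin n, 0 < D a.succ := fun a => hD a.succ
  have hD0 : 0 < D 0 := hD 0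
  have hS : 0 < Dsum D := Finset.sum_pos (fun i _ => hD i) Finset.univ_nonempty
  set Nm : Matrix (Fin n) (Fin n) ℝ := Matrix.diagonal (fun a => 1 / D a.succ)
      + Matrix.of (fun (_ : Fin n) (_ : Fin n) => 1 / D 0) with hNm
  have hN : ∀ k j, Nm k j = (if k = j then 1 / D k.succ else 0) + 1 / D 0 := by
    intro k j; simp [hNm, Matrix.add_apply, Matrix.diagonal_apply]
  set S' : ℝ := ∑ a : Fin n, D a.succ with hS'
  have hST : Dsum D = D 0 + S' := by
    rw [Dsum, Fin.sum_univ_succ]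
  have hcol : ∀ j, ∑ k, D k.succ * Nm k j = 1 + S' / D 0 := by
    intro j
    simp only [hN, mul_add, Finset.sum_add_distrib, mul_ite, mul_zero, Finset.sum_ite_eq',
      Finset.mem_univ, if_true]
    rw [mul_one_div, div_self (hD' j).ne', ← Finset.sum_mul, ← hS']
    ring
  ext i j
  rw [Matrix.mul_apply]
  have hsplit : ∀ k, NinvD D i k * Nm k j
      = (if i = k then D i.succ * Nm k j else 0) - 1 / Dsum D * D i.succ * (D k.succ * Nm k j) := by
    intro k
    rw [NinvD_apply]
    by_cases hik : i = k
    · subst hik; simp; ring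
    · rw [if_neg hik, if_neg hik]; ring
  rw [Finset.sum_congr rfl fun k _ => hsplit k, Finset.sum_sub_distrib, Finset.sum_ite_eq,
    ← Finset.mul_sum, hcol j]
  simp only [Finset.mem_univ, if_true, hN]
  by_cases hij : i = j
  · subst hij
    rw [if_pos rfl, Matrix.one_apply_eq, mul_add, mul_one_div, div_self (hD' i).ne']
    field_simp
    rw [hST]; ring
  · rw [if_neg hij, Matrix.one_apply_ne hij, zero_add]
    field_simp
    rw [hST]; ring


/-! ### §4 `refTᵀ Ñ⁻¹ refT = D − uuᵀ/ΣD` (`u = (D_i)`, all machines) -/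

/-- `ΣD = D_0 + ΣD′`. -/
theorem Dsum_eq (D : Fin (n + 1) → ℝ) : Dsum D = D 0 + ∑ a : Fin n, D a.succ := by
  rw [Dsum, Fin.sum_univ_succ]

/-- Row sums of `Ñ⁻¹`: `Σ_b Ñ⁻¹_{ab} = D′_a D_0 / ΣD`. -/
theorem NinvD_rowSum (D : Fin (n + 1) → ℝ) (hS : Dsum D ≠ 0) (a : Fin n) :
    ∑ b, NinvD D a b = D a.succ * D 0 / Dsum D := by
  simp only [NinvD_apply, Finset.sum_sub_distrib, Finset.sum_ite_eq, Finset.mem_univ, if_true,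
    ← Finset.mul_sum]
  rw [Dsum_eq] at hS ⊢
  field_simp
  ring

/-- `(Ñ⁻¹·refT)_{a, b+1} = Ñ⁻¹_{ab}`. -/
theorem NinvD_mul_refT_succ (D : Fin (n + 1) → ℝ) (a b : Fin n) :
    (NinvD D * refT n) a b.succ = NinvD D a b := by
  rw [Matrix.mul_apply]
  have hT : ∀ c : Fin n, refT n c b.succ = if b = c then 1 else 0 := by
    intro c
    show ((if b.succ = c.succ then (1 : ℝ) else 0) - (if b.succ = (0 : Fin (n + 1)) then 1 else 0)) = _
    simp [Fin.succ_inj, Fin.succ_ne_zero]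
  simp only [hT, mul_ite, mul_one, mul_zero, Finset.sum_ite_eq, Finset.mem_univ, if_true]

/-- `(Ñ⁻¹·refT)_{a, 0} = −D′_a D_0/ΣD`. -/
theorem NinvD_mul_refT_zero (D : Fin (n + 1) → ℝ) (hS : Dsum D ≠ 0) (a : Fin n) :
    (NinvD D * refT n) a 0 = -(D a.succ * D 0 / Dsum D) := by
  rw [Matrix.mul_apply]
  have hT : ∀ c : Fin n, refT n c 0 = -1 := by
    intro c
    show ((if (0 : Fin (n + 1)) = c.succ then (1 : ℝ) else 0) - (if (0 : Fin (n + 1)) = 0 then 1 else 0)) = _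
    rw [if_neg (Fin.succ_ne_zero c).symm, if_pos rfl]; ring
  simp only [hT, mul_neg, mul_one, Finset.sum_neg_distrib, NinvD_rowSum D hS]

/-- **`refTᵀ·Ñ⁻¹·refT = diag(D) − uuᵀ/ΣD`** (`u_i = D_i` over ALL machines): the `D`-weighted
projection off the common-speed direction, in closed form. -/
theorem refT_transpose_mul_NinvD_mul_refT (D : Fin (n + 1) → ℝ) (hS : Dsum D ≠ 0) :
    (refT n)ᵀ * (NinvD D * refT n) = Matrix.diagonal D - (1 / Dsum D) • Matrix.vecMulVec D D := by
  ext i j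
  rw [Matrix.mul_apply, Matrix.sub_apply, Matrix.smul_apply, Matrix.diagonal_apply,
    Matrix.vecMulVec_apply, smul_eq_mul]
  have hT : ∀ (c : Fin n) (i : Fin (n + 1)),
      (refT n)ᵀ i c = (if i = c.succ then 1 else 0) - (if i = 0 then 1 else 0) := fun c i => rfl
  -- column sums of `Ñ⁻¹·refT`
  have hcol0 : ∑ a : Fin n, (NinvD D * refT n) a 0 = -((∑ a : Fin n, D a.succ) * D 0 / Dsum D) := by
    simp only [NinvD_mul_refT_zero D hS, Finset.sum_neg_distrib, ← Finset.sum_div, ← Finset.sum_mul]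
  have hcolS : ∀ b : Fin n, ∑ a : Fin n, (NinvD D * refT n) a b.succ = D b.succ * D 0 / Dsum D := by
    intro b
    simp only [NinvD_mul_refT_succ]
    have hsym : ∀ a, NinvD D a b = NinvD D b a := fun a => by
      rw [← NinvD_transpose D, Matrix.transpose_apply, NinvD_transpose]
    simp only [hsym, NinvD_rowSum D hS]
  have hz : ∀ c : Fin n, ((0 : Fin (n + 1)) = c.succ) = False := fun c =>
    propext ⟨fun h => Fin.succ_ne_zero c h.symm, False.elim⟩
  cases i using Fin.cases with
  | zero =>
      simp only [hT, hz, if_false, if_true, zero_sub, neg_one_mul, Finset.sum_neg_distrib]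
      cases j using Fin.cases with
      | zero =>
          rw [hcol0, neg_neg, if_pos rfl]
          have hS2 : D 0 + ∑ a : Fin n, D a.succ ≠ 0 := by rwa [Dsum_eq] at hS
          rw [Dsum_eq]
          field_simp
          ring
      | succ b =>
          rw [hcolS b, if_neg (Fin.succ_ne_zero b).symm]
          ring
  | succ a =>
      have hS' : ∀ c : Fin n, (a.succ = c.succ) = (a = c) := fun c => propext Fin.succ_inj
      have hS0 : (a.succ = (0 : Fin (n + 1))) = False := propext ⟨Fin.succ_ne_zero a, False.elim⟩
      simp only [hT, hS', hS0, if_false, sub_zero, ite_mul, one_mul, zero_mul, Finset.sum_ite_eq,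
        Finset.mem_univ, if_true]
      cases j using Fin.cases with
      | zero =>
          rw [NinvD_mul_refT_zero D hS a, if_neg (Fin.succ_ne_zero a)]
          ring
      | succ b =>
          rw [NinvD_mul_refT_succ, NinvD_apply]
          by_cases hab : a = b
          · subst hab; simp
          · rw [if_neg hab, if_neg (fun h => hab (Fin.succ_inj.1 h))]

/-! ### §5 The residual in closed form: `X = 2c′D − h(2M − (muᵀ + umᵀ)/ΣD)` -/

/-- **The residual for `T = refT`, entrywise**:
`X_ij = [i = j](2c′D_i − 2hM_i) + (h/ΣD)(M_iD_j + D_iM_j)`. -/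
theorem XOf_refT_apply (M D : Fin (n + 1) → ℝ) (c' h : ℝ) (hS : Dsum D ≠ 0) (hM : ∀ i, M i ≠ 0)
    (hD : ∀ i, D i ≠ 0) (i j : Fin (n + 1)) :
    XOf M D (refT n) (NinvD D) c' h i j
      = (if i = j then 2 * c' * D i - 2 * h * M i else 0) + h / Dsum D * (M i * D j + D i * M j) := by
  have hI := refT_transpose_mul_NinvD_mul_refT D hS
  have h1 : (Q₂₁ M D (refT n) (NinvD D) h)ᵀ * refT n
      = h • (Matrix.diagonal (fun i => M i / D i) * (Matrix.diagonal D - (1 / Dsum D) • Matrix.vecMulVec D D)) := by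
    rw [Q₂₁, Matrix.transpose_smul, Matrix.transpose_mul, Matrix.transpose_mul, Matrix.diagonal_transpose,
      NinvD_transpose, Matrix.smul_mul, ← hI]
    simp only [Matrix.mul_assoc]
  have h2 : (refT n)ᵀ * Q₂₁ M D (refT n) (NinvD D) h
      = h • ((Matrix.diagonal D - (1 / Dsum D) • Matrix.vecMulVec D D) * Matrix.diagonal (fun i => M i / D i)) := by
    rw [Q₂₁, Matrix.mul_smul, ← hI]
    simp only [Matrix.mul_assoc]
  rw [XOf, h1, h2, Q₁₁]
  simp only [Matrix.add_apply, Matrix.sub_apply, Matrix.smul_apply, smul_eq_mul, Matrix.smul_mul,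
    Matrix.mul_smul, Matrix.diagonal_mul_diagonal, Matrix.diagonal_apply, Matrix.diagonal_mul,
    Matrix.mul_diagonal, Matrix.vecMulVec_apply, lamOf, Matrix.mul_sub, Matrix.sub_mul]
  by_cases hij : i = j
  · subst hij; simp only [if_true]; field_simp [hD i, hM i]; ring
  · simp only [if_neg hij]; field_simp [hD i, hD j]; ring

/-- The residual is symmetric. -/
theorem XOf_refT_transpose (M D : Fin (n + 1) → ℝ) (c' h : ℝ) (hS : Dsum D ≠ 0) (hM : ∀ i, M i ≠ 0)
    (hD : ∀ i, D i ≠ 0) : (XOf M D (refT n) (NinvD D) c' h)ᵀ = XOf M D (refT n) (NinvD D) c' h := by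
  ext i j
  rw [Matrix.transpose_apply, XOf_refT_apply M D c' h hS hM hD, XOf_refT_apply M D c' h hS hM hD]
  by_cases hij : i = j
  · subst hij; rfl
  · rw [if_neg hij, if_neg (Ne.symm hij)]; ring

/-- `X·v` in closed form (row `i`). -/
theorem XOf_refT_mulVec (M D : Fin (n + 1) → ℝ) (c' h : ℝ) (hS : Dsum D ≠ 0) (hM : ∀ i, M i ≠ 0)
    (hD : ∀ i, D i ≠ 0) (v : Fin (n + 1) → ℝ) (i : Fin (n + 1)) :
    (XOf M D (refT n) (NinvD D) c' h *ᵥ v) i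
      = (2 * c' * D i - 2 * h * M i) * v i
        + h / Dsum D * (M i * ∑ j, D j * v j + D i * ∑ j, M j * v j) := by
  simp only [Matrix.mulVec, dotProduct, XOf_refT_apply M D c' h hS hM hD, add_mul,
    Finset.sum_add_distrib, ite_mul, zero_mul, Finset.sum_ite_eq, Finset.mem_univ, if_true]
  congr 1
  have e : ∀ j, h / Dsum D * (M i * D j + D i * M j) * v j
      = h / Dsum D * M i * (D j * v j) + h / Dsum D * D i * (M j * v j) := fun j => by ring
  simp only [e, Finset.sum_add_distrib, ← Finset.mul_sum]
  ring

/-- **The residual's quadratic form**: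
`vᵀXv = Σ_i (2c′D_i − 2hM_i)v_i² + (2h/ΣD)·(Σ_i M_iv_i)(Σ_i D_iv_i)`. -/
theorem XOf_refT_quadForm (M D : Fin (n + 1) → ℝ) (c' h : ℝ) (hS : Dsum D ≠ 0) (hM : ∀ i, M i ≠ 0)
    (hD : ∀ i, D i ≠ 0) (v : Fin (n + 1) → ℝ) :
    v ⬝ᵥ (XOf M D (refT n) (NinvD D) c' h *ᵥ v)
      = ∑ i, (2 * c' * D i - 2 * h * M i) * v i ^ 2
        + 2 * h / Dsum D * ((∑ i, M i * v i) * (∑ i, D i * v i)) := by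
  simp only [dotProduct, XOf_refT_mulVec M D c' h hS hM hD]
  have e : ∀ i, v i * ((2 * c' * D i - 2 * h * M i) * v i
      + h / Dsum D * (M i * ∑ j, D j * v j + D i * ∑ j, M j * v j))
      = (2 * c' * D i - 2 * h * M i) * v i ^ 2
        + (h / Dsum D * ∑ j, D j * v j) * (M i * v i) + (h / Dsum D * ∑ j, M j * v j) * (D i * v i) :=
    fun i => by ring
  simp only [e, Finset.sum_add_distrib, ← Finset.mul_sum]
  ring

/-! ### §6 The SCALAR sufficient condition for the residual: `h(M_i/D_i + τ) ≤ c′`, `τ²ΣD ≥ ΣM²/D` -/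

/-- A real matrix with `Pᵀ = P` and a non-negative quadratic form is positive semidefinite
(plumbing). -/
private theorem posSemidef_of_transpose_of_nonneg' {m : Type*} [Fintype m] {P : Matrix m m ℝ}
    (hsymm : Pᵀ = P) (h : ∀ x : m → ℝ, 0 ≤ x ⬝ᵥ (P *ᵥ x)) : P.PosSemidef := by
  refine Matrix.PosSemidef.of_dotProduct_mulVec_nonneg ?_ fun x => ?_
  · rw [Matrix.IsHermitian, Matrix.conjTranspose_eq_transpose_of_trivial]
    exact hsymm
  · rw [star_trivial]
    exact h x

/-- Weighted Cauchy–Schwarz I: `(Σ D_iv_i)² ≤ (ΣD)·Σ D_iv_i²` (`D > 0`). -/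
theorem sq_sum_mul_le (D : Fin (n + 1) → ℝ) (hD : ∀ i, 0 < D i) (v : Fin (n + 1) → ℝ) :
    (∑ i, D i * v i) ^ 2 ≤ Dsum D * ∑ i, D i * v i ^ 2 := by
  have hcs := Finset.sum_mul_sq_le_sq_mul_sq Finset.univ (fun i => Real.sqrt (D i))
    (fun i => Real.sqrt (D i) * v i)
  have e1 : ∀ i, Real.sqrt (D i) * (Real.sqrt (D i) * v i) = D i * v i := fun i => by
    rw [← mul_assoc, Real.mul_self_sqrt (hD i).le]
  have e2 : ∀ i, Real.sqrt (D i) ^ 2 = D i := fun i => Real.sq_sqrt (hD i).le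
  have e3 : ∀ i, (Real.sqrt (D i) * v i) ^ 2 = D i * v i ^ 2 := fun i => by
    rw [mul_pow, Real.sq_sqrt (hD i).le]
  simp only [e1, e2, e3] at hcs
  exact hcs

/-- Weighted Cauchy–Schwarz II: `(Σ M_iv_i)² ≤ (Σ M_i²/D_i)·Σ D_iv_i²` (`D > 0`). -/
theorem sq_sum_mul_le' (M D : Fin (n + 1) → ℝ) (hD : ∀ i, 0 < D i) (v : Fin (n + 1) → ℝ) :
    (∑ i, M i * v i) ^ 2 ≤ (∑ i, M i ^ 2 / D i) * ∑ i, D i * v i ^ 2 := by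
  have hcs := Finset.sum_mul_sq_le_sq_mul_sq Finset.univ (fun i => M i / Real.sqrt (D i))
    (fun i => Real.sqrt (D i) * v i)
  have e1 : ∀ i, M i / Real.sqrt (D i) * (Real.sqrt (D i) * v i) = M i * v i := fun i => by
    have hs : Real.sqrt (D i) ≠ 0 := (Real.sqrt_pos.2 (hD i)).ne'
    field_simp
  have e2 : ∀ i, (M i / Real.sqrt (D i)) ^ 2 = M i ^ 2 / D i := fun i => by
    rw [div_pow, Real.sq_sqrt (hD i).le]
  have e3 : ∀ i, (Real.sqrt (D i) * v i) ^ 2 = D i * v i ^ 2 := fun i => by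
    rw [mul_pow, Real.sq_sqrt (hD i).le]
  simp only [e1, e2, e3] at hcs
  exact hcs

/-- **THE RESIDUAL IS POSITIVE SEMIDEFINITE UNDER A SCALAR CONDITION** (no semidefinite programme, any
number of machines): if `M, D > 0`, `h ≥ 0`, `τ ≥ 0` with `Σ_i M_i²/D_i ≤ τ²·ΣD`, and
`h·(M_i/D_i + τ) ≤ c′` for every machine `i`, then `X = 2c′D − h(2M − (muᵀ + umᵀ)/ΣD) ⪰ 0`
(two weighted Cauchy–Schwarz inequalities: `|Σ M_iv_i|·|Σ D_iv_i| ≤ τ·ΣD·Σ D_iv_i²`). The uniform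
case `D = λM` passes with `τ = 1/λ`, `h ≤ c′λ/2`. -/
theorem XOf_refT_posSemidef (M D : Fin (n + 1) → ℝ) (c' h : ℝ) (hM : ∀ i, 0 < M i)
    (hD : ∀ i, 0 < D i) (hh : 0 ≤ h) {τ : ℝ} (hτ : 0 ≤ τ)
    (hτ2 : ∑ i, M i ^ 2 / D i ≤ τ ^ 2 * Dsum D) (hcond : ∀ i, h * (M i / D i + τ) ≤ c') :
    (XOf M D (refT n) (NinvD D) c' h).PosSemidef := by
  have hS : 0 < Dsum D := Finset.sum_pos (fun i _ => hD i) Finset.univ_nonempty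
  have hM' : ∀ i, M i ≠ 0 := fun i => (hM i).ne'
  have hD' : ∀ i, D i ≠ 0 := fun i => (hD i).ne'
  refine posSemidef_of_transpose_of_nonneg' (XOf_refT_transpose M D c' h hS.ne' hM' hD') fun v => ?_
  rw [XOf_refT_quadForm M D c' h hS.ne' hM' hD']
  set A : ℝ := ∑ i, M i * v i with hA
  set B : ℝ := ∑ i, D i * v i with hB
  set P : ℝ := ∑ i, D i * v i ^ 2 with hP
  have hP0 : 0 ≤ P := Finset.sum_nonneg fun i _ => mul_nonneg (hD i).le (sq_nonneg _)
  have hB2 : B ^ 2 ≤ Dsum D * P := sq_sum_mul_le D hD v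
  have hA2 : A ^ 2 ≤ (∑ i, M i ^ 2 / D i) * P := sq_sum_mul_le' M D hD v
  -- `A·B ≥ −τ·ΣD·P`
  have hAB : -(τ * Dsum D * P) ≤ A * B := by
    have h1 : (A * B) ^ 2 ≤ (τ * Dsum D * P) ^ 2 := by
      calc (A * B) ^ 2 = A ^ 2 * B ^ 2 := by ring
        _ ≤ ((∑ i, M i ^ 2 / D i) * P) * (Dsum D * P) :=
            mul_le_mul hA2 hB2 (sq_nonneg _)
              (mul_nonneg (Finset.sum_nonneg fun i _ => div_nonneg (sq_nonneg _) (hD i).le) hP0)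
        _ ≤ (τ ^ 2 * Dsum D * P) * (Dsum D * P) :=
            mul_le_mul_of_nonneg_right (mul_le_mul_of_nonneg_right hτ2 hP0) (mul_nonneg hS.le hP0)
        _ = (τ * Dsum D * P) ^ 2 := by ring
    have h2 : |A * B| ≤ |τ * Dsum D * P| := sq_le_sq.1 h1
    rw [abs_of_nonneg (mul_nonneg (mul_nonneg hτ hS.le) hP0)] at h2
    linarith [neg_abs_le (A * B)]
  have hcross : -(2 * h * τ * P) ≤ 2 * h / Dsum D * (A * B) := by
    have h1 : 2 * h / Dsum D * (-(τ * Dsum D * P)) ≤ 2 * h / Dsum D * (A * B) :=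
      mul_le_mul_of_nonneg_left hAB (div_nonneg (mul_nonneg (by norm_num) hh) hS.le)
    have e : 2 * h / Dsum D * (-(τ * Dsum D * P)) = -(2 * h * τ * P) := by
      field_simp
    linarith
  -- the diagonal part absorbs the cross term
  have hdiag : 2 * h * τ * P ≤ ∑ i, (2 * c' * D i - 2 * h * M i) * v i ^ 2 := by
    have hre : ∑ i, (2 * c' * D i - 2 * h * M i) * v i ^ 2 - 2 * h * τ * P
        = ∑ i, (2 * c' * D i - 2 * h * M i - 2 * h * τ * D i) * v i ^ 2 := by
      simp only [hP, Finset.mul_sum, ← Finset.sum_sub_distrib]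
      exact Finset.sum_congr rfl fun i _ => by ring
    have hnn : 0 ≤ ∑ i, (2 * c' * D i - 2 * h * M i - 2 * h * τ * D i) * v i ^ 2 := by
      refine Finset.sum_nonneg fun i _ => mul_nonneg ?_ (sq_nonneg _)
      have hDi := hD i
      have hDne : D i ≠ 0 := hDi.ne'
      have h1 : h * (M i / D i + τ) * D i ≤ c' * D i := mul_le_mul_of_nonneg_right (hcond i) hDi.le
      have h2 : h * (M i / D i + τ) * D i = h * M i + h * τ * D i := by
        field_simp
      linarith
    linarith
  linarith

end Summit.Ventures.GridStability.Lyapunov.RelativeLffNU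

end
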